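import Summits.QuantumFields.BalabanUV.Beta.TubeHolAlgebra
import Summits.QuantumFields.BalabanUV.Beta.CapRowsLatticeJet
import Summits.QuantumFields.BalabanUV.Beta.CapRowsQhalfOneLoop

/-!
# Beta / CapRowsVertexTori — row CAP-k: the code16 anchors on the one-loop form ∕ the jet functional ∕ the paired (QHALF) ball with
# the (Z2) binder ON THE VERTEX TORI (β sub-cell, BINDER-OWNERS row CAP-k item (b), lineage `b2b-balaban-beta-an5`, gen 21; node
# BETA-an5-g21-FACE-MAXMOD part 3)

HONEST FRAMING (cell rule, page 1).  Discharging `BetaPertH` makes Bałaban's UV stability UNCONDITIONAL — a real constructive-QFT result; it is NOT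
the continuum limit and NOT the Clay problem.  HONEST DEPENDENCY: continuum YM on T⁴ ⇐ BetaPertH ∧ nine spine estimates (0/9 proved); BetaPertH ⇐
(D1) ∧ (D4) ∧ CAP+tail; G-an2-4 gates asym, D1 and NE2/3/4.  KERNEL GLUE ONLY: nothing below instantiates a binder; no `κ, a, M, C, N, t, r` is
asserted; no certificate is consumed or produced; 0 certified coefficients.

WHAT.  `CapRowsLattice.rowsOfOneLoopFormCode16E` (v1.2 p204209), `CapRowsLatticeJet.rowsOf…₂` (p204293) and `CapRowsQhalfOneLoop.rowsOf…_ofRealBall₂`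
(p206406) take the (Z2) certificate as a bound `hM` ∕ `hC` on the whole polystrip `Strip 4 κ` (8 real dimensions).  Every pricing of that
certificate in the cell reads it off the 16 VERTEX TORI `Im q = κ·s`, `s ∈ {±1}⁴` (4 real dimensions; CAP-KERNEL §4.10 (i) THEOREM MP, §4.15 (b)
«M = max_face |G|», route A's `B_a := max over the face leaves`).  With the distinguished-boundary maximum principle now in the kernel
(`TubeMaximumModulus.TubeHol.norm_le_of_vertexTori`, `TubeHolAlgebra.stripRegularC_oneLoopForm_ofVertexTori`), this module re-issues the three
anchors and their certified-road ENDs with the (Z2) binder in that currency: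

* §1 (any dimension) the binder theorems at two widths: `stripRegularC_oneLoopForm₂_ofVertexTori` (STRUCTURE `MatTubeHol` ×5 and (Z1) on
  `Strip (d+1) a` ONCE at the zero-free half-width `a`; the bound `M` of `t₁ − t₂` on `VertexTori κ`, `κ ≤ a`), `norm_le_strip_of_vertexTori₃`
  (a three-slot family bounded on `VertexTori κ × closedBall r × sphere r` is bounded on `Strip κ × closedBall r × sphere r`, given `TubeHol` in `q`
  at each `(p₁, p₂)`), `stripRegularC_jet_of_vertexToriBound₂` (LEMMA JC with the uniform `C` certified on the vertex tori × discs only).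
* §2 (d + 1 = 4, code16 engine convention) the rows `rowsOfOneLoopFormCode16E_ofVertexTori₂`, `rowsOfJetCode16E_ofVertexTori₂` and their
  certified-road ENDs `betaAvgAFH_of_…` — binders by kind: (N) dictionary ∣ STRUCTURE `MatTubeHol` ×5 (resp. `PolyHol (jetFunctional f)` +
  `TubeHol` of the `q`-slices) ∣ (Z1) on `Strip 4 a` ∣ **(Z2) on `VertexTori κ` (resp. `VertexTori κ × closedBall r × sphere r`)** ∣ (T) ∣ (A) ∣ cmp;
  + rate ∕ `hk₂` ∕ (D4) for the END.
* §3 the paired (QHALF) real-ball row `rowsOfOneLoopFormCode16E_ofRealBall_ofVertexTori₂` + END (REALITY `MatConjSymm` ×5 ⟹ `hsym` by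
  `ConjReflectionAlgebra.oneLoopForm_hsym`, as in `CapRowsQhalfOneLoop`).

Everything is a composition of named tree theorems; [folklore]; 0 `sorry`; 0 cite tags.
-/

namespace Summit.QuantumFields.BalabanUV.Beta.CapRowsVertexTori

open Literature.MathematicalPhysics.QuantumFieldTheory.Balaban1983to89
open Literature.MathematicalPhysics.QuantumFieldTheory.Balaban1983to89.Beta
open FlowStep FlowStepRuns DagBinding
open B4Strip (Strip)
open B4ContourShift (latticeKernel)
open B4TorusKernel (descend gridPt)
open Metric
open Beta.RemainderChain (RemainderConst)
open Beta.RateCertificate (GeomRate)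
open Beta.AveragedAFCarrier (BetaAvgAFH)
open Beta.AliasingTailL1 (StripRegularC aliasRatioL1)
open Beta.AliasingTailLattice (codeTheta code16SetE)
open Summit.QuantumFields.BalabanUV.Beta.CapRows
open Summit.QuantumFields.BalabanUV.Beta.CapRowsLattice (rowsOfCode16E betaAvgAFH_of_anchorCode16E)
open Summit.QuantumFields.BalabanUV.Beta.CapRowsQhalf (rowsOfCode16E_ofRealBall rowsOfCode16E_ofRealBall_consts)
open Summit.QuantumFields.BalabanUV.Beta.PolyRegularAlgebra (PolyHol MatPolyHol)
open Summit.QuantumFields.BalabanUV.Beta.PolyRegularRestrict (stripRegularC_jet_of_bound₂)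
open Summit.QuantumFields.BalabanUV.Beta.JetCoefficientCauchy (jetFunctional)
open Summit.QuantumFields.BalabanUV.Beta.ConjReflectionAlgebra (MatConjSymm oneLoopForm_hsym)
open Summit.QuantumFields.BalabanUV.Beta.TubeMaximumModulus

noncomputable section

/-! ## §1 The binder theorems with the bound on the vertex tori (any dimension, two widths) -/

section Binders

variable {d : ℕ} {n : Type*} [Fintype n] [DecidableEq n]
variable {A A' B C D : (Fin (d + 1) → ℂ) → Matrix n n ℂ} {a κ M : ℝ}

/-- **THE ONE-LOOP FORM AT TWO WIDTHS, (Z2) ON THE VERTEX TORI**: STRUCTURE `MatTubeHol` ×5 and (Z1) `det ≠ 0` on `Strip (d+1) a` ONCE at the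
zero-free half-width `a`; a certified bound `M` of `t₁ − t₂` on `VertexTori κ` (`κ ≤ a`; the `2^{d+1}` shifted real tori `Im q = κ·s`) ⟹
`StripRegularC (t₁ − t₂) κ M`. [folklore] -/
theorem stripRegularC_oneLoopForm₂_ofVertexTori (hκa : κ ≤ a) (hA : MatTubeHol A (fun _ => a)) (hA' : MatTubeHol A' (fun _ => a))
    (hBst : MatTubeHol B (fun _ => a)) (hBs : MatTubeHol C (fun _ => a)) (hBt : MatTubeHol D (fun _ => a))
    (hdet : ∀ p ∈ Strip (d + 1) a, (A p).det ≠ 0) (hdet' : ∀ p ∈ Strip (d + 1) a, (A' p).det ≠ 0)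
    (hM : ∀ p ∈ VertexTori (fun _ : Fin (d + 1) => κ), ‖((A p)⁻¹ * B p).trace - ((A p)⁻¹ * C p * (A' p)⁻¹ * D p).trace‖ ≤ M) :
    StripRegularC (fun p => ((A p)⁻¹ * B p).trace - ((A p)⁻¹ * C p * (A' p)⁻¹ * D p).trace) κ M :=
  ((tubeHol_oneLoopForm hA hA' hBst hBs hBt hdet hdet').of_le fun _ => hκa).stripRegularC_of_vertexTori hM

/-- **A THREE-SLOT FAMILY BOUNDED ON THE VERTEX TORI × DISCS IS BOUNDED ON THE STRIP × DISCS**: for every `(p₁, p₂) ∈ closedBall r × sphere r`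
the `q`-slice `q ↦ f q p₁ p₂` is `TubeHol` at half-width `κ`, and `‖f q p₁ p₂‖ ≤ C` for `q` on `VertexTori κ` ⟹ the same for `q ∈ Strip (d+1) κ`
— the uniform `C` of LEMMA JC is certified on the vertex tori × discs only. [folklore] -/
theorem norm_le_strip_of_vertexTori₃ {f : (Fin (d + 1) → ℂ) → ℂ → ℂ → ℂ} {r C : ℝ}
    (hf : ∀ p₁ ∈ closedBall (0 : ℂ) r, ∀ p₂ ∈ sphere (0 : ℂ) r, TubeHol (fun q => f q p₁ p₂) (fun _ : Fin (d + 1) => κ))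
    (hC : ∀ q ∈ VertexTori (fun _ : Fin (d + 1) => κ), ∀ p₁ ∈ closedBall (0 : ℂ) r, ∀ p₂ ∈ sphere (0 : ℂ) r, ‖f q p₁ p₂‖ ≤ C) :
    ∀ q ∈ Strip (d + 1) κ, ∀ p₁ ∈ closedBall (0 : ℂ) r, ∀ p₂ ∈ sphere (0 : ℂ) r, ‖f q p₁ p₂‖ ≤ C :=
  fun q hq p₁ hp₁ p₂ hp₂ =>
    (hf p₁ hp₁ p₂ hp₂).norm_le_of_vertexTori (fun q' hq' => hC q' hq' p₁ hp₁ p₂ hp₂) q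
      (polyStrip_subset_tube (fun _ : Fin (d + 1) => κ) hq)

/-- **LEMMA JC AT TWO WIDTHS WITH `C` ON THE VERTEX TORI**: `PolyHol (jetFunctional f)` at half-width `a`, the mixed-Cauchy slice data on
`Strip κ` (`κ ≤ a`), `TubeHol` of the `q`-slices at each `(p₁, p₂)`, and a uniform certified `C` on `VertexTori κ × closedBall r × sphere r` ⟹
`StripRegularC (jetFunctional f) κ (C/(2r²))`. [folklore] -/
theorem stripRegularC_jet_of_vertexToriBound₂ {f : (Fin (d + 1) → ℂ) → ℂ → ℂ → ℂ} {r C : ℝ} (hr : 0 < r) (hκa : κ ≤ a)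
    (hG : PolyHol (jetFunctional f) (fun _ => a))
    (h₂ : ∀ q ∈ Strip (d + 1) κ, ∀ p₁ ∈ closedBall (0 : ℂ) r, DiffContOnCl ℂ (f q p₁) (ball 0 r))
    (hf : ∀ p₁ ∈ closedBall (0 : ℂ) r, ∀ p₂ ∈ sphere (0 : ℂ) r, TubeHol (fun q => f q p₁ p₂) (fun _ : Fin (d + 1) => κ))
    (hC : ∀ q ∈ VertexTori (fun _ : Fin (d + 1) => κ), ∀ p₁ ∈ closedBall (0 : ℂ) r, ∀ p₂ ∈ sphere (0 : ℂ) r, ‖f q p₁ p₂‖ ≤ C)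
    (h₁ : ∀ q ∈ Strip (d + 1) κ, DiffContOnCl ℂ (fun p₁ => deriv (f q p₁) 0) (ball 0 r)) :
    StripRegularC (jetFunctional f) κ (C / (2 * r ^ 2)) :=
  stripRegularC_jet_of_bound₂ hr hκa hG h₂ (norm_le_strip_of_vertexTori₃ hf hC) h₁

end Binders

/-! ## §2 The code16 rows (d + 1 = 4) with (Z2) on the vertex tori, and their certified-road ENDs -/

section Rows

variable {b : ℕ → ℝ} {n : Type*} [Fintype n] [DecidableEq n]
variable {A A' B C D : (Fin 4 → ℂ) → Matrix n n ℂ} {a κ M : ℝ}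

/-- **THE ONE-LOOP-FORM ANCHOR AT TWO WIDTHS, (Z2) ON THE 16 VERTEX TORI** (code16, engine convention).  Binders by kind: (N) `hb` the level-0
DICTIONARY (row D1); STRUCTURE `hA…hBt : MatTubeHol _ (fun _ => a)` (automatic for character sums: `TubeHolAlgebra.matTubeHol_characterSum`);
(Z1) `hdet hdet'` on `Strip 4 a` (certificate); **(Z2) `hM` on `VertexTori κ` only** (certificate; `0 < κ ≤ a`); (T) `hT` the two-engine ball for
the mean over `code16SetE N`; (A) `hA₀` (kernel: `CapLatticeBudget.budget_code16_*` ∕ `_param`); cmp `hlo` ⟹ `Rows b`, `k₀ = 0`, `lo 0 = lo`. [folklore] -/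
def rowsOfOneLoopFormCode16E_ofVertexTori₂
    (hb : b 0 = (latticeKernel (fun p => ((A p)⁻¹ * B p).trace - ((A p)⁻¹ * C p * (A' p)⁻¹ * D p).trace) 0).re)
    (hκ : 0 < κ) (hκa : κ ≤ a) (hA : MatTubeHol A (fun _ => a)) (hA' : MatTubeHol A' (fun _ => a))
    (hBst : MatTubeHol B (fun _ => a)) (hBs : MatTubeHol C (fun _ => a)) (hBt : MatTubeHol D (fun _ => a))
    (hdet : ∀ p ∈ Strip (3 + 1) a, (A p).det ≠ 0) (hdet' : ∀ p ∈ Strip (3 + 1) a, (A' p).det ≠ 0)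
    (hM : ∀ p ∈ VertexTori (fun _ : Fin (3 + 1) => κ), ‖((A p)⁻¹ * B p).trace - ((A p)⁻¹ * C p * (A' p)⁻¹ * D p).trace‖ ≤ M)
    {N : ℕ} (hN : 1 ≤ N) [NeZero (4 * N)] {t r : ℝ}
    (hT : ‖((code16SetE N).card : ℂ)⁻¹ *
        (∑ w ∈ code16SetE N, descend (fun p => ((A p)⁻¹ * B p).trace - ((A p)⁻¹ * C p * (A' p)⁻¹ * D p).trace)
          (gridPt (4 * N) w)) - t‖ ≤ r)
    {A₀ : ℝ} (hA₀ : M * codeTheta (aliasRatioL1 κ N) ≤ A₀) (lo : ℚ) (hlo : ((lo : ℚ) : ℝ) ≤ t - r - A₀) : Rows b :=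
  rowsOfCode16E hb (stripRegularC_oneLoopForm₂_ofVertexTori hκa hA hA' hBst hBs hBt hdet hdet' hM) hκ hN hT hA₀ lo hlo

variable {β : HBeta}

/-- **THE CERTIFIED ROAD FROM THE ONE-LOOP-FORM ANCHOR, (Z2) ON THE VERTEX TORI** — row CAP-k's typed target in ONE signature with the
certificate in the engines' currency: the binders of `rowsOfOneLoopFormCode16E_ofVertexTori₂` (`b := S.β0`) + `GeomRate S.β0 binf c₀ θ`
(`0 ≤ θ ≤ 1`) + `hk₂` at `k₀ = 0` + `RemainderConst S γ₀ r′` ⟹ `BetaAvgAFH (min lo (3(lo − c₀)/4) − r′) 0 γ₀ β`.  0 of these binders is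
instantiated in the tree. [folklore] -/
theorem betaAvgAFH_of_oneLoopFormCode16E_ofVertexTori₂ (S : B12Beta.OneLoopSplit β)
    (hb : S.β0 0 = (latticeKernel (fun p => ((A p)⁻¹ * B p).trace - ((A p)⁻¹ * C p * (A' p)⁻¹ * D p).trace) 0).re)
    (hκ : 0 < κ) (hκa : κ ≤ a) (hA : MatTubeHol A (fun _ => a)) (hA' : MatTubeHol A' (fun _ => a))
    (hBst : MatTubeHol B (fun _ => a)) (hBs : MatTubeHol C (fun _ => a)) (hBt : MatTubeHol D (fun _ => a))
    (hdet : ∀ p ∈ Strip (3 + 1) a, (A p).det ≠ 0) (hdet' : ∀ p ∈ Strip (3 + 1) a, (A' p).det ≠ 0)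
    (hM : ∀ p ∈ VertexTori (fun _ : Fin (3 + 1) => κ), ‖((A p)⁻¹ * B p).trace - ((A p)⁻¹ * C p * (A' p)⁻¹ * D p).trace‖ ≤ M)
    {N : ℕ} (hN : 1 ≤ N) [NeZero (4 * N)] {t rT : ℝ}
    (hT : ‖((code16SetE N).card : ℂ)⁻¹ *
        (∑ w ∈ code16SetE N, descend (fun p => ((A p)⁻¹ * B p).trace - ((A p)⁻¹ * C p * (A' p)⁻¹ * D p).trace)
          (gridPt (4 * N) w)) - t‖ ≤ rT)
    {A₀ : ℝ} (hA₀ : M * codeTheta (aliasRatioL1 κ N) ≤ A₀) (lo : ℚ) (hlo : ((lo : ℚ) : ℝ) ≤ t - rT - A₀)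
    {γ₀ binf c₀ θ r : ℝ} (hθ0 : 0 ≤ θ) (hθ1 : θ ≤ 1) (hconv : GeomRate S.β0 binf c₀ θ)
    (hk₂ : c₀ * θ ^ (0 + 1) ≤ ((lo : ℝ) - c₀ * θ ^ 0) / 4) (hrem : RemainderConst S γ₀ r) :
    BetaAvgAFH (min ((lo : ℚ) : ℝ) (3 * ((lo : ℝ) - c₀ * θ ^ 0) / 4) - r) 0 γ₀ β :=
  betaAvgAFH_of_anchorCode16E S hb (stripRegularC_oneLoopForm₂_ofVertexTori hκa hA hA' hBst hBs hBt hdet hdet' hM) hκ hN hT hA₀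
    lo hlo hθ0 hθ1 hconv hk₂ hrem

/-- **THE JET-FUNCTIONAL ANCHOR AT TWO WIDTHS, `C` ON THE VERTEX TORI × DISCS** (code16, engine convention): `G = jetFunctional f`; STRUCTURE
`hG : PolyHol (jetFunctional f) (fun _ => a)` and `hf : TubeHol` of every `q`-slice `q ↦ f q p₁ p₂` at half-width `κ`; the mixed-Cauchy slice data
`h₂`, `h₁` on `Strip 4 κ`; **(Z2) a UNIFORM certified `C ≥ ‖f‖` on `VertexTori κ × closedBall r × sphere r` only**; the tail with
`M := C/(2r²)`; (T), cmp ⟹ `Rows b`, `k₀ = 0`. [folklore] -/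
def rowsOfJetCode16E_ofVertexTori₂ {f : (Fin 4 → ℂ) → ℂ → ℂ → ℂ} {r C : ℝ}
    (hb : b 0 = (latticeKernel (jetFunctional f) 0).re) (hκ : 0 < κ) (hκa : κ ≤ a) (hr : 0 < r)
    (hG : PolyHol (jetFunctional f) (fun _ => a))
    (h₂ : ∀ q ∈ Strip (3 + 1) κ, ∀ p₁ ∈ closedBall (0 : ℂ) r, DiffContOnCl ℂ (f q p₁) (ball 0 r))
    (hf : ∀ p₁ ∈ closedBall (0 : ℂ) r, ∀ p₂ ∈ sphere (0 : ℂ) r, TubeHol (fun q => f q p₁ p₂) (fun _ : Fin (3 + 1) => κ))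
    (hC : ∀ q ∈ VertexTori (fun _ : Fin (3 + 1) => κ), ∀ p₁ ∈ closedBall (0 : ℂ) r, ∀ p₂ ∈ sphere (0 : ℂ) r, ‖f q p₁ p₂‖ ≤ C)
    (h₁ : ∀ q ∈ Strip (3 + 1) κ, DiffContOnCl ℂ (fun p₁ => deriv (f q p₁) 0) (ball 0 r))
    {N : ℕ} (hN : 1 ≤ N) [NeZero (4 * N)] {t rT : ℝ}
    (hT : ‖((code16SetE N).card : ℂ)⁻¹ * (∑ w ∈ code16SetE N, descend (jetFunctional f) (gridPt (4 * N) w)) - t‖ ≤ rT)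
    {A₀ : ℝ} (hA₀ : C / (2 * r ^ 2) * codeTheta (aliasRatioL1 κ N) ≤ A₀) (lo : ℚ) (hlo : ((lo : ℚ) : ℝ) ≤ t - rT - A₀) :
    Rows b :=
  rowsOfCode16E hb (stripRegularC_jet_of_vertexToriBound₂ hr hκa hG h₂ hf hC h₁) hκ hN hT hA₀ lo hlo

/-- **THE CERTIFIED ROAD FROM THE JET-FUNCTIONAL ANCHOR, `C` ON THE VERTEX TORI × DISCS.** [folklore] -/
theorem betaAvgAFH_of_jetCode16E_ofVertexTori₂ (S : B12Beta.OneLoopSplit β) {f : (Fin 4 → ℂ) → ℂ → ℂ → ℂ} {r C : ℝ}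
    (hb : S.β0 0 = (latticeKernel (jetFunctional f) 0).re) (hκ : 0 < κ) (hκa : κ ≤ a) (hr : 0 < r)
    (hG : PolyHol (jetFunctional f) (fun _ => a))
    (h₂ : ∀ q ∈ Strip (3 + 1) κ, ∀ p₁ ∈ closedBall (0 : ℂ) r, DiffContOnCl ℂ (f q p₁) (ball 0 r))
    (hf : ∀ p₁ ∈ closedBall (0 : ℂ) r, ∀ p₂ ∈ sphere (0 : ℂ) r, TubeHol (fun q => f q p₁ p₂) (fun _ : Fin (3 + 1) => κ))
    (hC : ∀ q ∈ VertexTori (fun _ : Fin (3 + 1) => κ), ∀ p₁ ∈ closedBall (0 : ℂ) r, ∀ p₂ ∈ sphere (0 : ℂ) r, ‖f q p₁ p₂‖ ≤ C)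
    (h₁ : ∀ q ∈ Strip (3 + 1) κ, DiffContOnCl ℂ (fun p₁ => deriv (f q p₁) 0) (ball 0 r))
    {N : ℕ} (hN : 1 ≤ N) [NeZero (4 * N)] {t rT : ℝ}
    (hT : ‖((code16SetE N).card : ℂ)⁻¹ * (∑ w ∈ code16SetE N, descend (jetFunctional f) (gridPt (4 * N) w)) - t‖ ≤ rT)
    {A₀ : ℝ} (hA₀ : C / (2 * r ^ 2) * codeTheta (aliasRatioL1 κ N) ≤ A₀) (lo : ℚ) (hlo : ((lo : ℚ) : ℝ) ≤ t - rT - A₀)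
    {γ₀ binf c₀ θ r' : ℝ} (hθ0 : 0 ≤ θ) (hθ1 : θ ≤ 1) (hconv : GeomRate S.β0 binf c₀ θ)
    (hk₂ : c₀ * θ ^ (0 + 1) ≤ ((lo : ℝ) - c₀ * θ ^ 0) / 4) (hrem : RemainderConst S γ₀ r') :
    BetaAvgAFH (min ((lo : ℚ) : ℝ) (3 * ((lo : ℝ) - c₀ * θ ^ 0) / 4) - r') 0 γ₀ β :=
  betaAvgAFH_of_anchorCode16E S hb (stripRegularC_jet_of_vertexToriBound₂ hr hκa hG h₂ hf hC h₁) hκ hN hT hA₀ lo hlo hθ0 hθ1 hconv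
    hk₂ hrem

end Rows

/-! ## §3 The paired (QHALF) real-ball row with (Z2) on the vertex tori -/

section Qhalf

variable {b : ℕ → ℝ} {n : Type*} [Fintype n] [DecidableEq n]
variable {A A' B C D : (Fin 4 → ℂ) → Matrix n n ℂ} {a κ M : ℝ}

/-- **THE PAIRED-BALL ANCHOR ON THE ONE-LOOP FORM, (Z2) ON THE VERTEX TORI** (code16, engine convention; two widths): STRUCTURE `MatTubeHol` ×5 at
`a`, REALITY `MatConjSymm` ×5 (⟹ `hsym` by `ConjReflectionAlgebra.oneLoopForm_hsym`), (Z1) on `Strip 4 a`, **(Z2) `hM` on `VertexTori κ`**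
(`0 < κ ≤ a`), (T) a certified REAL ball for `|S_E|⁻¹ Σ_{S_E} Re G`, (A), cmp ⟹ `Rows b`, `k₀ = 0`. [folklore] -/
def rowsOfOneLoopFormCode16E_ofRealBall_ofVertexTori₂
    (hb : b 0 = (latticeKernel (fun p => ((A p)⁻¹ * B p).trace - ((A p)⁻¹ * C p * (A' p)⁻¹ * D p).trace) 0).re)
    (hκ : 0 < κ) (hκa : κ ≤ a) (hA : MatTubeHol A (fun _ => a)) (hA' : MatTubeHol A' (fun _ => a))
    (hBst : MatTubeHol B (fun _ => a)) (hBs : MatTubeHol C (fun _ => a)) (hBt : MatTubeHol D (fun _ => a))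
    (rA : MatConjSymm A) (rA' : MatConjSymm A') (rBst : MatConjSymm B) (rBs : MatConjSymm C) (rBt : MatConjSymm D)
    (hdet : ∀ p ∈ Strip (3 + 1) a, (A p).det ≠ 0) (hdet' : ∀ p ∈ Strip (3 + 1) a, (A' p).det ≠ 0)
    (hM : ∀ p ∈ VertexTori (fun _ : Fin (3 + 1) => κ), ‖((A p)⁻¹ * B p).trace - ((A p)⁻¹ * C p * (A' p)⁻¹ * D p).trace‖ ≤ M)
    {N : ℕ} (hN : 1 ≤ N) [NeZero (4 * N)] {t r : ℝ}
    (hT : |((code16SetE N).card : ℝ)⁻¹ *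
        (∑ w ∈ code16SetE N, (descend (fun p => ((A p)⁻¹ * B p).trace - ((A p)⁻¹ * C p * (A' p)⁻¹ * D p).trace)
          (gridPt (4 * N) w)).re) - t| ≤ r)
    {A₀ : ℝ} (hA₀ : M * codeTheta (aliasRatioL1 κ N) ≤ A₀) (lo : ℚ) (hlo : ((lo : ℚ) : ℝ) ≤ t - r - A₀) : Rows b :=
  rowsOfCode16E_ofRealBall hb (stripRegularC_oneLoopForm₂_ofVertexTori hκa hA hA' hBst hBs hBt hdet hdet' hM) hκ
    (oneLoopForm_hsym rA rA' rBst rBs rBt) hN hT hA₀ lo hlo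

variable {β : HBeta}

/-- **THE CERTIFIED ROAD FROM THE PAIRED-BALL ANCHOR, (Z2) ON THE VERTEX TORI**: the binders of
`rowsOfOneLoopFormCode16E_ofRealBall_ofVertexTori₂` (`b := S.β0`) + rate + `hk₂` at `k₀ = 0` + `RemainderConst S γ₀ r′` ⟹
`BetaAvgAFH (min lo (3(lo − c₀)/4) − r′) 0 γ₀ β`.  0 binders instantiated. [folklore] -/
theorem betaAvgAFH_of_oneLoopFormCode16E_ofRealBall_ofVertexTori₂ (S : B12Beta.OneLoopSplit β)
    (hb : S.β0 0 = (latticeKernel (fun p => ((A p)⁻¹ * B p).trace - ((A p)⁻¹ * C p * (A' p)⁻¹ * D p).trace) 0).re)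
    (hκ : 0 < κ) (hκa : κ ≤ a) (hA : MatTubeHol A (fun _ => a)) (hA' : MatTubeHol A' (fun _ => a))
    (hBst : MatTubeHol B (fun _ => a)) (hBs : MatTubeHol C (fun _ => a)) (hBt : MatTubeHol D (fun _ => a))
    (rA : MatConjSymm A) (rA' : MatConjSymm A') (rBst : MatConjSymm B) (rBs : MatConjSymm C) (rBt : MatConjSymm D)
    (hdet : ∀ p ∈ Strip (3 + 1) a, (A p).det ≠ 0) (hdet' : ∀ p ∈ Strip (3 + 1) a, (A' p).det ≠ 0)
    (hM : ∀ p ∈ VertexTori (fun _ : Fin (3 + 1) => κ), ‖((A p)⁻¹ * B p).trace - ((A p)⁻¹ * C p * (A' p)⁻¹ * D p).trace‖ ≤ M)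
    {N : ℕ} (hN : 1 ≤ N) [NeZero (4 * N)] {t rT : ℝ}
    (hT : |((code16SetE N).card : ℝ)⁻¹ *
        (∑ w ∈ code16SetE N, (descend (fun p => ((A p)⁻¹ * B p).trace - ((A p)⁻¹ * C p * (A' p)⁻¹ * D p).trace)
          (gridPt (4 * N) w)).re) - t| ≤ rT)
    {A₀ : ℝ} (hA₀ : M * codeTheta (aliasRatioL1 κ N) ≤ A₀) (lo : ℚ) (hlo : ((lo : ℚ) : ℝ) ≤ t - rT - A₀)
    {γ₀ binf c₀ θ r : ℝ} (hθ0 : 0 ≤ θ) (hθ1 : θ ≤ 1) (hconv : GeomRate S.β0 binf c₀ θ)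
    (hk₂ : c₀ * θ ^ (0 + 1) ≤ ((lo : ℝ) - c₀ * θ ^ 0) / 4) (hrem : RemainderConst S γ₀ r) :
    BetaAvgAFH (min ((lo : ℚ) : ℝ) (3 * ((lo : ℝ) - c₀ * θ ^ 0) / 4) - r) 0 γ₀ β := by
  have key := betaAvgAFH_of_capRows S
    (rowsOfOneLoopFormCode16E_ofRealBall_ofVertexTori₂ hb hκ hκa hA hA' hBst hBs hBt rA rA' rBst rBs rBt hdet hdet' hM hN hT hA₀
      lo hlo) hθ0 hθ1 hconv hk₂ hrem
  rwa [rowsOfOneLoopFormCode16E_ofRealBall_ofVertexTori₂,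
    (rowsOfCode16E_ofRealBall_consts hb (stripRegularC_oneLoopForm₂_ofVertexTori hκa hA hA' hBst hBs hBt hdet hdet' hM) hκ
      (oneLoopForm_hsym rA rA' rBst rBs rBt) hN hT hA₀ lo hlo).2.2] at key

end Qhalf

/-! ## §4 (v1.1, APPEND-ONLY) GENERIC multipliers: ANY `TubeHol G` with a bound on the 16 vertex tori

The rows of §2–§3 are typed for the one-loop SHAPE `t₁ − t₂` (resp. the jet functional via LEMMA JC).  The integrand the engines
actually sum (cap5's 744-dim jet functional `tr[𝒢 k_stᴸ] + Σ tr[Wᵃ Ȳᵇ]` with the `Y`-recursion, CAP-KERNEL §4.15 (a); cap1's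
ONE-LOOP-PIECES) is an EXPANDED form: a finite sum of trace words in `k₀(q)⁻¹` and (derivative) stencil families — a `TubeHol`
function by `TubeHolAlgebra` (`MatTubeHol.mul/.inv/.trace`, `matTubeHol_characterSum`, `TubeHol.sum`) once its tables are typed,
WITHOUT matching the `t₁ − t₂` shape.  The generic rows below serve any such `G` directly: STRUCTURE = `TubeHol G` ((Z1) inside,
wherever `G` contains inverses), (Z2) = a bound on `VertexTori κ`. -/

section Generic

open scoped ComplexConjugate

variable {b : ℕ → ℝ} {G : (Fin 4 → ℂ) → ℂ} {a κ M : ℝ}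

/-- **THE GENERIC ANCHOR, (Z2) ON THE 16 VERTEX TORI** (code16, engine convention; two widths).  Binders by kind: (N) `hb`;
STRUCTURE `hG : TubeHol G (fun _ => a)`; **(Z2) `hM` on `VertexTori κ`** (`0 < κ ≤ a`); (T) `hT`; (A) `hA₀`; cmp `hlo` ⟹ `Rows b`,
`k₀ = 0`, `lo 0 = lo`. [folklore] -/
def rowsOfCode16E_ofVertexTori₂ (hb : b 0 = (latticeKernel G 0).re) (hκ : 0 < κ) (hκa : κ ≤ a)
    (hG : TubeHol G (fun _ => a)) (hM : ∀ p ∈ VertexTori (fun _ : Fin (3 + 1) => κ), ‖G p‖ ≤ M)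
    {N : ℕ} (hN : 1 ≤ N) [NeZero (4 * N)] {t r : ℝ}
    (hT : ‖((code16SetE N).card : ℂ)⁻¹ * (∑ w ∈ code16SetE N, descend G (gridPt (4 * N) w)) - t‖ ≤ r)
    {A₀ : ℝ} (hA₀ : M * codeTheta (aliasRatioL1 κ N) ≤ A₀) (lo : ℚ) (hlo : ((lo : ℚ) : ℝ) ≤ t - r - A₀) : Rows b :=
  rowsOfCode16E hb ((hG.of_le fun _ => hκa).stripRegularC_of_vertexTori hM) hκ hN hT hA₀ lo hlo

/-- its constants: `k₀ = 0`, `m = m₀ = lo`. [folklore] -/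
theorem rowsOfCode16E_ofVertexTori₂_consts (hb : b 0 = (latticeKernel G 0).re) (hκ : 0 < κ) (hκa : κ ≤ a)
    (hG : TubeHol G (fun _ => a)) (hM : ∀ p ∈ VertexTori (fun _ : Fin (3 + 1) => κ), ‖G p‖ ≤ M)
    {N : ℕ} (hN : 1 ≤ N) [NeZero (4 * N)] {t r : ℝ}
    (hT : ‖((code16SetE N).card : ℂ)⁻¹ * (∑ w ∈ code16SetE N, descend G (gridPt (4 * N) w)) - t‖ ≤ r)
    {A₀ : ℝ} (hA₀ : M * codeTheta (aliasRatioL1 κ N) ≤ A₀) (lo : ℚ) (hlo : ((lo : ℚ) : ℝ) ≤ t - r - A₀) :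
    (rowsOfCode16E_ofVertexTori₂ hb hκ hκa hG hM hN hT hA₀ lo hlo).k₀ = 0 ∧
      (rowsOfCode16E_ofVertexTori₂ hb hκ hκa hG hM hN hT hA₀ lo hlo).m = lo ∧
      (rowsOfCode16E_ofVertexTori₂ hb hκ hκa hG hM hN hT hA₀ lo hlo).m₀ = lo := by
  refine ⟨rfl, rfl, ?_⟩
  simp [Rows.m₀, rowsOfCode16E_ofVertexTori₂, rowsOfCode16E]

variable {β : HBeta}

/-- **THE CERTIFIED ROAD FROM THE GENERIC ANCHOR**: the binders of `rowsOfCode16E_ofVertexTori₂` (`b := S.β0`) + `GeomRate S.β0 binf c₀ θ`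
(`0 ≤ θ ≤ 1`) + `hk₂` at `k₀ = 0` + `RemainderConst S γ₀ r′` ⟹ `BetaAvgAFH (min lo (3(lo − c₀)/4) − r′) 0 γ₀ β`.  0 binders instantiated. [folklore] -/
theorem betaAvgAFH_of_code16E_ofVertexTori₂ (S : B12Beta.OneLoopSplit β) (hb : S.β0 0 = (latticeKernel G 0).re) (hκ : 0 < κ)
    (hκa : κ ≤ a) (hG : TubeHol G (fun _ => a)) (hM : ∀ p ∈ VertexTori (fun _ : Fin (3 + 1) => κ), ‖G p‖ ≤ M)
    {N : ℕ} (hN : 1 ≤ N) [NeZero (4 * N)] {t rT : ℝ}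
    (hT : ‖((code16SetE N).card : ℂ)⁻¹ * (∑ w ∈ code16SetE N, descend G (gridPt (4 * N) w)) - t‖ ≤ rT)
    {A₀ : ℝ} (hA₀ : M * codeTheta (aliasRatioL1 κ N) ≤ A₀) (lo : ℚ) (hlo : ((lo : ℚ) : ℝ) ≤ t - rT - A₀)
    {γ₀ binf c₀ θ r : ℝ} (hθ0 : 0 ≤ θ) (hθ1 : θ ≤ 1) (hconv : GeomRate S.β0 binf c₀ θ)
    (hk₂ : c₀ * θ ^ (0 + 1) ≤ ((lo : ℝ) - c₀ * θ ^ 0) / 4) (hrem : RemainderConst S γ₀ r) :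
    BetaAvgAFH (min ((lo : ℚ) : ℝ) (3 * ((lo : ℝ) - c₀ * θ ^ 0) / 4) - r) 0 γ₀ β :=
  betaAvgAFH_of_anchorCode16E S hb ((hG.of_le fun _ => hκa).stripRegularC_of_vertexTori hM) hκ hN hT hA₀ lo hlo hθ0 hθ1
    hconv hk₂ hrem

/-- **THE GENERIC PAIRED-BALL (QHALF) ANCHOR, (Z2) ON THE VERTEX TORI**: + the conjugation symmetry `hsym` (for the typed families:
`ConjReflectionAlgebra.ConjSymm.hsym`), (T) a certified REAL ball for `|S_E|⁻¹ Σ_{S_E} Re G`. [folklore] -/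
def rowsOfCode16E_ofRealBall_ofVertexTori₂ (hb : b 0 = (latticeKernel G 0).re) (hκ : 0 < κ) (hκa : κ ≤ a)
    (hG : TubeHol G (fun _ => a)) (hsym : ∀ p : Fin 4 → ℝ, G (B4Strip.ofRealVec (-p)) = conj (G (B4Strip.ofRealVec p)))
    (hM : ∀ p ∈ VertexTori (fun _ : Fin (3 + 1) => κ), ‖G p‖ ≤ M) {N : ℕ} (hN : 1 ≤ N) [NeZero (4 * N)] {t r : ℝ}
    (hT : |((code16SetE N).card : ℝ)⁻¹ * (∑ w ∈ code16SetE N, (descend G (gridPt (4 * N) w)).re) - t| ≤ r)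
    {A₀ : ℝ} (hA₀ : M * codeTheta (aliasRatioL1 κ N) ≤ A₀) (lo : ℚ) (hlo : ((lo : ℚ) : ℝ) ≤ t - r - A₀) : Rows b :=
  rowsOfCode16E_ofRealBall hb ((hG.of_le fun _ => hκa).stripRegularC_of_vertexTori hM) hκ hsym hN hT hA₀ lo hlo

/-- **THE CERTIFIED ROAD FROM THE GENERIC PAIRED-BALL ANCHOR.** [folklore] -/
theorem betaAvgAFH_of_code16E_ofRealBall_ofVertexTori₂ (S : B12Beta.OneLoopSplit β) (hb : S.β0 0 = (latticeKernel G 0).re)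
    (hκ : 0 < κ) (hκa : κ ≤ a) (hG : TubeHol G (fun _ => a))
    (hsym : ∀ p : Fin 4 → ℝ, G (B4Strip.ofRealVec (-p)) = conj (G (B4Strip.ofRealVec p)))
    (hM : ∀ p ∈ VertexTori (fun _ : Fin (3 + 1) => κ), ‖G p‖ ≤ M) {N : ℕ} (hN : 1 ≤ N) [NeZero (4 * N)] {t rT : ℝ}
    (hT : |((code16SetE N).card : ℝ)⁻¹ * (∑ w ∈ code16SetE N, (descend G (gridPt (4 * N) w)).re) - t| ≤ rT)
    {A₀ : ℝ} (hA₀ : M * codeTheta (aliasRatioL1 κ N) ≤ A₀) (lo : ℚ) (hlo : ((lo : ℚ) : ℝ) ≤ t - rT - A₀)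
    {γ₀ binf c₀ θ r : ℝ} (hθ0 : 0 ≤ θ) (hθ1 : θ ≤ 1) (hconv : GeomRate S.β0 binf c₀ θ)
    (hk₂ : c₀ * θ ^ (0 + 1) ≤ ((lo : ℝ) - c₀ * θ ^ 0) / 4) (hrem : RemainderConst S γ₀ r) :
    BetaAvgAFH (min ((lo : ℚ) : ℝ) (3 * ((lo : ℝ) - c₀ * θ ^ 0) / 4) - r) 0 γ₀ β := by
  have key := betaAvgAFH_of_capRows S
    (rowsOfCode16E_ofRealBall_ofVertexTori₂ hb hκ hκa hG hsym hM hN hT hA₀ lo hlo) hθ0 hθ1 hconv hk₂ hrem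
  rwa [rowsOfCode16E_ofRealBall_ofVertexTori₂,
    (rowsOfCode16E_ofRealBall_consts hb ((hG.of_le fun _ => hκa).stripRegularC_of_vertexTori hM) hκ hsym hN hT hA₀
      lo hlo).2.2] at key

end Generic

end

end Summit.QuantumFields.BalabanUV.Beta.CapRowsVertexTori
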